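import Mathlib
import HarnessLib
import Summits.HubbardSuperconductivity.HubbardSuperconductivity.Theorems.KLProgrammeKLRegimeEngineV8TwoLegMomentsExportGrid
import Summits.HubbardSuperconductivity.HubbardSuperconductivity.Theorems.KLProgrammeKLRegimeEngineE4ScaleDoor

/-!
# Route `KLProgramme` — ENGINE child gen 8 (stmt-HubbardSuperconductivity-20437 `KLRegimeEngineV17F2`), token #23 (the GRID two-leg moments atom,
# `…EngineV8TwoLegMomentsExportGrid`, p557865): the MODEL-HALF CONVERSION of plan g19's question (2c) — the atom from PER-SCALE weighted
# increment masses (cell gate-hubbard-kl, seat hubbard-kl-r2d-p1 g8)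

The tower's question (2c) (KL STATUS 2026-08-27 (R59o)(ii)): does the one-shot tower at the flow frame `K_n` deliver the two pinned `4M`-grid sums of
`kernel₂ (W_n[K_n] − 𝒩_{K_n,4M})` with n-FREE budgets?  The cumulative two-leg kernel cannot be converted from ONE weighted mass (its ultraviolet part has
mass `O(U²)`, not `O(U²Λ_n)`), but it can from the fixed-frame SLICE INCREMENTS, each weighted at ITS OWN scale: if
`kernel₂ (W_n[K] − 𝒩_{K,4M}) ((p₀,σ,+),(p₁,σ,−)) = Σ_{j ≤ n} Δ_j σ p₀ p₁` (any decomposition — e.g. this lineage's exact slice-increment identity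
`kernel_two_klEffectiveAction_succ_sub_eq`, …SplitTwoLegIncrementRep, read on the grid) and for every `j ≤ n`, both spins and every pin
`Σ_{p₁} klScaleWt L M β j {pos p₀, pos p₁} · ‖Δ_j σ p₀ p₁‖ ≤ m j` (the tower's `klScaleWt j = 1 + Λ_j·diam` currency, …EngineE4ScaleDoor), then the two
rows of `TwoLegGridMomentsAt L M Zt Zs β U μ K n` hold as soon as `Σ_{j ≤ n} m j / Λ_j ≤ Zt·U²·β/(2N)` and `2·Σ_{j ≤ n} m j / Λ_j ≤ Zs·U²·β/(2N)` — by the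
two elementary dominations **`(β/N)·circDist_N(j₀,j₁) ≤ klScaleWt j {pos p₀, pos p₁} / Λ_j`** and
**`[x⃗₁ ≠ x⃗₀]·(1+|Δx̃₀|+|Δx̃₁|) ≤ 2·klScaleWt j {pos p₀, pos p₁} / Λ_j`** (`0 < Λ_j ≤ 1`).  So «(2c) YES» costs the suppliers exactly: weighted PLAIN-leg
increment masses `m j` with `Σ_j m j·4^j` finite uniformly in `n` (BGM's `γ^{h}·γ^{ϑh}` for `n_e = 2`).

* `time_weight_le_klScaleWt_div`, `offDiag_weight_le_klScaleWt_div` — the two dominations;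
* **`twoLegGridMomentsAt_of_increments`** — the conversion (any frame `K`, any scale `n`, any decomposition `Δ`).

Proofs only; no definitions; nothing about the model is asserted; nothing asserts superconductivity.
References: BGM 2006 §2.3 (2.17), §3 (3.2)–(3.3) [cite: BenfattoGiulianiMastropietro2006].
-/

noncomputable section

namespace Summit.HubbardSuperconductivity.HubbardSuperconductivity.Theorems.EngineV8

set_option linter.dupNamespace false -- summit = problem name (single-conjunct summit), D-0017

open Real Finset Literature.MathematicalPhysics.QuantumLattice Literature.Probability.LatticeModels GrassmannAlgebra
open Literature.Probability.LatticeModels.BattleFederbush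
open Summit.HubbardSuperconductivity.HubbardSuperconductivity.Theorems.KLProgrammeLegKernels
open Summit.HubbardSuperconductivity.HubbardSuperconductivity.Theorems.KLRegimeSplit

section Dominations

variable {L M : ℕ} [NeZero L] [NeZero M]

/-- **TIME DOMINATION**: `(β/N)·circDist_N(j₀,j₁) ≤ klScaleWt L M β j {pos p₀, pos p₁} / Λ_j` (`0 ≤ β`; the grid time distance is one summand of
`gridLabelDist`, the pair's distance is at most the diameter, and `klScaleWt j = 1 + Λ_j·diam ≥ Λ_j·diam`). -/
theorem time_weight_le_klScaleWt_div {β : ℝ} (hβ : 0 ≤ β) (j : ℕ) (p₀ p₁ : GridPoint L (2 * (2 * M))) :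
    β / ((2 * (2 * M) : ℕ) : ℝ) * (circDist (2 * (2 * M)) p₀.1.val p₁.1.val : ℝ) ≤
      klScaleWt L M β j {((((p₀.1 : ℕ) : ZMod (2 * (2 * M)))), p₀.2), ((((p₁.1 : ℕ) : ZMod (2 * (2 * M)))), p₁.2)} / klScale klE0 j := by
  haveI : NeZero (2 * (2 * M)) := ⟨by have := NeZero.ne M; omega⟩
  have hΛ : 0 < klScale klE0 j := by unfold klScale klE0; positivity
  -- the time distance is one summand of the label distance of the pair
  have h1 : β / ((2 * (2 * M) : ℕ) : ℝ) * (circDist (2 * (2 * M)) p₀.1.val p₁.1.val : ℝ) ≤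
      gridLabelDist L (2 * (2 * M)) β ((((p₀.1 : ℕ) : ZMod (2 * (2 * M)))), p₀.2) ((((p₁.1 : ℕ) : ZMod (2 * (2 * M)))), p₁.2) := by
    rw [gridLabelDist_apply, circDist_eq_cyclicDist]
    dsimp only
    have ht : 0 ≤ torusSiteDist p₀.2 p₁.2 := (isLabelDist_torusSiteDist (d := 2) (L := L)).nonneg _ _
    have _ := hβ
    linarith
  -- the pair's distance is at most the diameter, and `Λ_j·diam ≤ klScaleWt`
  have h2 : gridLabelDist L (2 * (2 * M)) β ((((p₀.1 : ℕ) : ZMod (2 * (2 * M)))), p₀.2) ((((p₁.1 : ℕ) : ZMod (2 * (2 * M)))), p₁.2) ≤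
      labelDiam (gridLabelDist L (2 * (2 * M)) β)
        {((((p₀.1 : ℕ) : ZMod (2 * (2 * M)))), p₀.2), ((((p₁.1 : ℕ) : ZMod (2 * (2 * M)))), p₁.2)} :=
    le_labelDiam _ (mem_insert_self _ _) (mem_insert_of_mem (mem_singleton_self _))
  rw [le_div_iff₀ hΛ, klScaleWt_apply]
  nlinarith [h1.trans h2, hΛ]

/-- **SPACE DOMINATION**: `[x⃗₁ ≠ x⃗₀]·(1+|Δx̃₀|+|Δx̃₁|) ≤ 2·klScaleWt L M β j {pos p₀, pos p₁} / Λ_j` (`0 ≤ β`, `Λ_j ≤ 1`: each centred coordinate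
difference is at most the periodic `ℓ^∞` distance, itself one summand of `gridLabelDist`; then `1 + diam ≤ (1 + Λ_j·diam)/Λ_j`). -/
theorem offDiag_weight_le_klScaleWt_div {β : ℝ} (hβ : 0 ≤ β) (j : ℕ) (p₀ p₁ : GridPoint L (2 * (2 * M))) :
    (if p₁.2 - p₀.2 = 0 then (0 : ℝ) else
        (1 + (((p₁.2 - p₀.2) 0).valMinAbs.natAbs : ℝ) + (((p₁.2 - p₀.2) 1).valMinAbs.natAbs : ℝ)) ^ 1) ≤
      2 * klScaleWt L M β j {((((p₀.1 : ℕ) : ZMod (2 * (2 * M)))), p₀.2), ((((p₁.1 : ℕ) : ZMod (2 * (2 * M)))), p₁.2)} / klScale klE0 j := by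
  haveI : NeZero (2 * (2 * M)) := ⟨by have := NeZero.ne M; omega⟩
  have hΛ : 0 < klScale klE0 j := by unfold klScale klE0; positivity
  have hΛ1 : klScale klE0 j ≤ 1 := by
    unfold klScale klE0
    have h4 : (1 : ℝ) ≤ (4 : ℝ) ^ j := one_le_pow₀ (by norm_num)
    exact mul_le_one₀ (by norm_num) (inv_nonneg.2 (zero_le_one.trans h4)) (inv_le_one_of_one_le₀ h4)
  have h0 := natAbs_valMinAbs_sub_le_torusSiteDist p₀.2 p₁.2 0
  have h1 := natAbs_valMinAbs_sub_le_torusSiteDist p₀.2 p₁.2 1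
  have hts : torusSiteDist p₀.2 p₁.2 ≤
      gridLabelDist L (2 * (2 * M)) β ((((p₀.1 : ℕ) : ZMod (2 * (2 * M)))), p₀.2) ((((p₁.1 : ℕ) : ZMod (2 * (2 * M)))), p₁.2) := by
    rw [gridLabelDist_apply]
    dsimp only
    have hc : 0 ≤ β / ((2 * (2 * M) : ℕ) : ℝ) *
        cyclicDist (2 * (2 * M)) (((p₀.1 : ℕ) : ZMod (2 * (2 * M)))) (((p₁.1 : ℕ) : ZMod (2 * (2 * M)))) :=
      mul_nonneg (by positivity) ((isLabelDist_cyclicDist (2 * (2 * M))).nonneg _ _)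
    linarith
  have h2 : gridLabelDist L (2 * (2 * M)) β ((((p₀.1 : ℕ) : ZMod (2 * (2 * M)))), p₀.2) ((((p₁.1 : ℕ) : ZMod (2 * (2 * M)))), p₁.2) ≤
      labelDiam (gridLabelDist L (2 * (2 * M)) β)
        {((((p₀.1 : ℕ) : ZMod (2 * (2 * M)))), p₀.2), ((((p₁.1 : ℕ) : ZMod (2 * (2 * M)))), p₁.2)} :=
    le_labelDiam _ (mem_insert_self _ _) (mem_insert_of_mem (mem_singleton_self _))
  have hD0 : 0 ≤ labelDiam (gridLabelDist L (2 * (2 * M)) β)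
      {((((p₀.1 : ℕ) : ZMod (2 * (2 * M)))), p₀.2), ((((p₁.1 : ℕ) : ZMod (2 * (2 * M)))), p₁.2)} := labelDiam_nonneg _ _
  rw [le_div_iff₀ hΛ, klScaleWt_apply]
  split_ifs
  · nlinarith
  · rw [pow_one]
    -- `(1 + a₀ + a₁)·Λ ≤ (1 + 2D)·Λ ≤ 2(1 + Λ D)` for `Λ ≤ 1`
    have hsum : (1 + (((p₁.2 - p₀.2) 0).valMinAbs.natAbs : ℝ) + (((p₁.2 - p₀.2) 1).valMinAbs.natAbs : ℝ)) ≤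
        1 + 2 * labelDiam (gridLabelDist L (2 * (2 * M)) β)
          {((((p₀.1 : ℕ) : ZMod (2 * (2 * M)))), p₀.2), ((((p₁.1 : ℕ) : ZMod (2 * (2 * M)))), p₁.2)} := by linarith
    nlinarith [mul_le_mul_of_nonneg_right hsum hΛ.le, mul_nonneg hΛ.le hD0]

end Dominations

/-! ## The conversion -/

section Conversion

variable {L M : ℕ} [NeZero L] [NeZero M]

/-- **THE GRID ATOM FROM PER-SCALE WEIGHTED INCREMENT MASSES** (any frame `K`, any scale `n`): given ANY decomposition of the pinned two-leg grid kernel of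
`W' = W_n[K] − 𝒩_{K,4M}` into increments `Δ j` (`j ≤ n`), weighted pinned masses `Σ_{p₁} klScaleWt j {pos p₀, pos p₁}·‖Δ j σ p₀ p₁‖ ≤ m j` at each increment's
OWN scale, and the two budget lines `Σ_{j ≤ n} m j/Λ_j ≤ Zt·U²·β/(2N)`, `2·Σ_{j ≤ n} m j/Λ_j ≤ Zs·U²·β/(2N)`: `TwoLegGridMomentsAt L M Zt Zs β U μ K n`. -/
theorem twoLegGridMomentsAt_of_increments {β U μ : ℝ} (hβ : 0 ≤ β) {K : TrigPolyC4v} {n : ℕ}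
    (Δ : ℕ → Fin 2 → GridPoint L (2 * (2 * M)) → GridPoint L (2 * (2 * M)) → ℂ) {m : ℕ → ℝ} {Zt Zs : ℝ}
    (hsum : ∀ (σ : Fin 2) (p₀ p₁ : GridPoint L (2 * (2 * M))),
      kernel ℂ
          (effAction ℂ ((hubbardGridSub L M β (2 * (2 * M))).transpose *
              hubbardCovAboveCT L M β μ 0 K (klScale klE0 n) * hubbardGridSub L M β (2 * (2 * M)))
            (hubbardGridInteraction L (2 * (2 * M)) β U + hubbardGridCounterQuadratic L (2 * (2 * M)) β K) -
            hubbardGridCounterQuadratic L (2 * (2 * M)) β K) 2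
          (fun i => ((![p₀, p₁] i, σ), i)) = ∑ j ∈ range (n + 1), Δ j σ p₀ p₁)
    (hm : ∀ j ≤ n, ∀ (σ : Fin 2) (p₀ : GridPoint L (2 * (2 * M))), ∑ p₁ : GridPoint L (2 * (2 * M)),
      klScaleWt L M β j {((((p₀.1 : ℕ) : ZMod (2 * (2 * M)))), p₀.2), ((((p₁.1 : ℕ) : ZMod (2 * (2 * M)))), p₁.2)} * ‖Δ j σ p₀ p₁‖ ≤ m j)
    (hZt : ∑ j ∈ range (n + 1), m j / klScale klE0 j ≤ Zt * U ^ 2 * (β / (2 * ((2 * (2 * M) : ℕ) : ℝ))))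
    (hZs : 2 * ∑ j ∈ range (n + 1), m j / klScale klE0 j ≤ Zs * U ^ 2 * (β / (2 * ((2 * (2 * M) : ℕ) : ℝ)))) :
    TwoLegGridMomentsAt L M Zt Zs β U μ K n := by
  -- per-increment rows
  have hrow : ∀ (w : GridPoint L (2 * (2 * M)) → GridPoint L (2 * (2 * M)) → ℝ) (c : ℝ), (∀ p₀ p₁, 0 ≤ w p₀ p₁) →
      (∀ j p₀ p₁, w p₀ p₁ ≤ c * klScaleWt L M β j
        {((((p₀.1 : ℕ) : ZMod (2 * (2 * M)))), p₀.2), ((((p₁.1 : ℕ) : ZMod (2 * (2 * M)))), p₁.2)} / klScale klE0 j) →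
      ∀ (σ : Fin 2) (p₀ : GridPoint L (2 * (2 * M))),
        ∑ p₁ : GridPoint L (2 * (2 * M)), w p₀ p₁ * ‖∑ j ∈ range (n + 1), Δ j σ p₀ p₁‖ ≤
          c * ∑ j ∈ range (n + 1), m j / klScale klE0 j := by
    intro w c hw0 hwle σ p₀
    calc ∑ p₁ : GridPoint L (2 * (2 * M)), w p₀ p₁ * ‖∑ j ∈ range (n + 1), Δ j σ p₀ p₁‖
        ≤ ∑ p₁ : GridPoint L (2 * (2 * M)), ∑ j ∈ range (n + 1), w p₀ p₁ * ‖Δ j σ p₀ p₁‖ := by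
          refine sum_le_sum fun p₁ _ => ?_
          rw [← mul_sum]
          exact mul_le_mul_of_nonneg_left (norm_sum_le _ _) (hw0 p₀ p₁)
      _ = ∑ j ∈ range (n + 1), ∑ p₁ : GridPoint L (2 * (2 * M)), w p₀ p₁ * ‖Δ j σ p₀ p₁‖ := sum_comm
      _ ≤ ∑ j ∈ range (n + 1), c * (m j / klScale klE0 j) := by
          refine sum_le_sum fun j hj => ?_
          have hjn : j ≤ n := Nat.lt_succ_iff.1 (mem_range.1 hj)
          have hΛ : 0 < klScale klE0 j := by unfold klScale klE0; positivity
          calc ∑ p₁ : GridPoint L (2 * (2 * M)), w p₀ p₁ * ‖Δ j σ p₀ p₁‖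
              ≤ ∑ p₁ : GridPoint L (2 * (2 * M)), c * klScaleWt L M β j
                  {((((p₀.1 : ℕ) : ZMod (2 * (2 * M)))), p₀.2), ((((p₁.1 : ℕ) : ZMod (2 * (2 * M)))), p₁.2)} / klScale klE0 j *
                  ‖Δ j σ p₀ p₁‖ := sum_le_sum fun p₁ _ => mul_le_mul_of_nonneg_right (hwle j p₀ p₁) (norm_nonneg _)
            _ = c * ((∑ p₁ : GridPoint L (2 * (2 * M)), klScaleWt L M β j
                  {((((p₀.1 : ℕ) : ZMod (2 * (2 * M)))), p₀.2), ((((p₁.1 : ℕ) : ZMod (2 * (2 * M)))), p₁.2)} * ‖Δ j σ p₀ p₁‖) /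
                  klScale klE0 j) := by
                rw [sum_div, mul_sum]
                refine sum_congr rfl fun p₁ _ => ?_
                ring
            _ ≤ c * (m j / klScale klE0 j) := by
                have hc : 0 ≤ c := by
                  have h := hwle j p₀ p₀
                  have hW : 0 < klScaleWt L M β j
                      {((((p₀.1 : ℕ) : ZMod (2 * (2 * M)))), p₀.2), ((((p₀.1 : ℕ) : ZMod (2 * (2 * M)))), p₀.2)} := by
                    rw [klScaleWt_apply]
                    have := labelDiam_nonneg (gridLabelDist L (2 * (2 * M)) β)
                      {((((p₀.1 : ℕ) : ZMod (2 * (2 * M)))), p₀.2), ((((p₀.1 : ℕ) : ZMod (2 * (2 * M)))), p₀.2)}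
                    positivity
                  by_contra hlt
                  have : c * klScaleWt L M β j
                      {((((p₀.1 : ℕ) : ZMod (2 * (2 * M)))), p₀.2), ((((p₀.1 : ℕ) : ZMod (2 * (2 * M)))), p₀.2)} / klScale klE0 j < 0 :=
                    div_neg_of_neg_of_pos (mul_neg_of_neg_of_pos (lt_of_not_ge hlt) hW) hΛ
                  linarith [hw0 p₀ p₀]
                exact mul_le_mul_of_nonneg_left (div_le_div_of_nonneg_right (hm j hjn σ p₀) hΛ.le) hc
      _ = c * ∑ j ∈ range (n + 1), m j / klScale klE0 j := by rw [← mul_sum]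
  refine ⟨fun σ p₀ => ?_, fun σ p₀ => ?_⟩
  · have h := hrow (fun p₀ p₁ => β / ((2 * (2 * M) : ℕ) : ℝ) * (circDist (2 * (2 * M)) p₀.1.val p₁.1.val : ℝ)) 1
      (fun p₀ p₁ => by positivity) (fun j p₀ p₁ => by rw [one_mul]; exact time_weight_le_klScaleWt_div hβ j p₀ p₁) σ p₀
    rw [one_mul] at h
    refine le_trans (le_of_eq (sum_congr rfl fun p₁ _ => ?_)) (h.trans hZt)
    rw [hsum σ p₀ p₁]
  · have h := hrow (fun p₀ p₁ => if p₁.2 - p₀.2 = 0 then (0 : ℝ) else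
        (1 + (((p₁.2 - p₀.2) 0).valMinAbs.natAbs : ℝ) + (((p₁.2 - p₀.2) 1).valMinAbs.natAbs : ℝ)) ^ 1) 2
      (fun p₀ p₁ => by split_ifs <;> positivity) (fun j p₀ p₁ => offDiag_weight_le_klScaleWt_div hβ j p₀ p₁) σ p₀
    refine le_trans (le_of_eq (sum_congr rfl fun p₁ _ => ?_)) (h.trans hZs)
    rw [hsum σ p₀ p₁]

end Conversion

end Summit.HubbardSuperconductivity.HubbardSuperconductivity.Theorems.EngineV8

end
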